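import Summits.MatrixMultiplication.MatrixMultiplication.Theorems.SoloBlindCorankTwoStar

/-!
# Conjecture E at corank two: H-goodness kills and the four-representation rigidity

Sub-programme (K₃) / Conjecture E, setting of `SoloBlindCorankTwoKraft` (`G` of exponent `3`, `B` sum-distinct,
`S = B ∪ {p, q}`, `a = h p`, `b = h q`).  Tools for the non-star case of Conjecture E at corank two
(`SoloBlindConjETwo`):

* `soloBlind_hgood_zero/_one/_two` — H-GOODNESS KILLS: a subset of `B` plus zero, one or two of the outside
  indices cannot sum to `τ + τ`.
* `soloBlind_pair_sum_signed` — exponent-`3` bookkeeping `∑A + ∑A' = ∑(A ∆ A') - ∑(A ∩ A')`.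
* `soloBlind_rep_rigidity` — FOUR-REPRESENTATION RIGIDITY: if `A₀, A₁, A₂, A₃ ⊆ B` satisfy
  `∑A₀ + ∑A₃ = ∑A₁ + ∑A₂` (as the representations of `τ, τ-a, τ-b, τ-a-b` do), then
  `A₀ ∩ A₃ = A₁ ∩ A₂` and `A₀ ∆ A₃ = A₁ ∆ A₂` — by signed sum-distinctness.  Consequently (in the main file) an
  index of `A₁ \ A₃` lies in `A₀ \ A₂`, and when all four representations are present and legal one gets
  `|A₀| ≥ 3, |A₁| ≥ 2, |A₂| ≥ 2, |A₃| ≥ 1`, whence `E ≤ 1/8 + 1/8 + 1/8 + 1/8`.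
-/

namespace Summit.MatrixMultiplication.MatrixMultiplication.Theorems

open Finset

universe u

variable {ι : Type*} [DecidableEq ι]
variable {G : Type u} [AddCommGroup G] [DecidableEq G]

/-! ## H-goodness kills -/

omit [DecidableEq ι] [DecidableEq G] in
/-- A subset of `B ⊆ S` cannot sum to `τ + τ` when `τ` is H-good on `S`. -/
theorem soloBlind_hgood_zero {h : ι → G} {S B : Finset ι} {τ : G} (hgood : ∀ T ⊆ S, ∑ i ∈ T, h i ≠ τ + τ)
    (hBS : B ⊆ S) {A : Finset ι} (hA : A ⊆ B) (e : ∑ i ∈ A, h i = τ + τ) : False :=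
  hgood A (hA.trans hBS) e

omit [DecidableEq G] in
/-- A subset of `B` plus one outside index cannot sum to `τ + τ`. -/
theorem soloBlind_hgood_one {h : ι → G} {S B : Finset ι} {τ : G} (hgood : ∀ T ⊆ S, ∑ i ∈ T, h i ≠ τ + τ)
    (hBS : B ⊆ S) {x : ι} (hxS : x ∈ S) (hxB : x ∉ B) {A : Finset ι} (hA : A ⊆ B)
    (e : ∑ i ∈ A, h i + h x = τ + τ) : False :=
  hgood (insert x A) (Finset.insert_subset hxS (hA.trans hBS))
    (by rw [Finset.sum_insert (fun hx => hxB (hA hx)), add_comm, e])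

omit [DecidableEq G] in
/-- A subset of `B` plus two outside indices cannot sum to `τ + τ`. -/
theorem soloBlind_hgood_two {h : ι → G} {S B : Finset ι} {τ : G} (hgood : ∀ T ⊆ S, ∑ i ∈ T, h i ≠ τ + τ)
    (hBS : B ⊆ S) {x y : ι} (hxS : x ∈ S) (hyS : y ∈ S) (hxB : x ∉ B) (hyB : y ∉ B) (hxy : x ≠ y)
    {A : Finset ι} (hA : A ⊆ B) (e : ∑ i ∈ A, h i + h x + h y = τ + τ) : False := by
  have hx' : x ∉ insert y A := by
    intro hx
    rcases Finset.mem_insert.mp hx with hx | hx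
    · exact hxy hx
    · exact hxB (hA hx)
  refine hgood (insert x (insert y A))
    (Finset.insert_subset hxS (Finset.insert_subset hyS (hA.trans hBS))) ?_
  rw [Finset.sum_insert hx', Finset.sum_insert (fun hy => hyB (hA hy))]
  have key : h x + (h y + ∑ i ∈ A, h i) = ∑ i ∈ A, h i + h x + h y := by abel
  rw [key]
  exact e

/-! ## Four-representation rigidity -/

omit [DecidableEq G] in
/-- Exponent-`3` bookkeeping: `∑A + ∑A' = ∑(A \ A' ∪ A' \ A) - ∑(A ∩ A')`. -/
theorem soloBlind_pair_sum_signed (three : ∀ g : G, g + g + g = 0) (h : ι → G) (A A' : Finset ι) :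
    ∑ i ∈ A, h i + ∑ i ∈ A', h i = ∑ i ∈ (A \ A' ∪ A' \ A), h i - ∑ i ∈ A ∩ A', h i := by
  have dA := Finset.sum_filter_add_sum_filter_not A (fun i => i ∈ A') (fun i => h i)
  have dA' := Finset.sum_filter_add_sum_filter_not A' (fun i => i ∈ A) (fun i => h i)
  have e1 : A.filter (fun i => i ∈ A') = A ∩ A' := by ext i; simp [Finset.mem_inter]
  have e2 : A.filter (fun i => ¬ i ∈ A') = A \ A' := by ext i; simp [Finset.mem_sdiff]
  have e3 : A'.filter (fun i => i ∈ A) = A ∩ A' := by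
    ext i; simp only [Finset.mem_filter, Finset.mem_inter]; tauto
  have e4 : A'.filter (fun i => ¬ i ∈ A) = A' \ A := by ext i; simp [Finset.mem_sdiff]
  rw [e1, e2] at dA
  rw [e3, e4] at dA'
  rw [Finset.sum_union disjoint_sdiff_sdiff, ← dA, ← dA']
  have t := three (∑ i ∈ A ∩ A', h i)
  have key : ∑ i ∈ A ∩ A', h i + ∑ i ∈ A ∩ A', h i = -∑ i ∈ A ∩ A', h i := by
    rw [← sub_eq_zero]
    rw [← t]
    abel
  calc ∑ i ∈ A ∩ A', h i + ∑ i ∈ A \ A', h i + (∑ i ∈ A ∩ A', h i + ∑ i ∈ A' \ A, h i)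
      = ∑ i ∈ A \ A', h i + ∑ i ∈ A' \ A, h i + (∑ i ∈ A ∩ A', h i + ∑ i ∈ A ∩ A', h i) := by abel
    _ = ∑ i ∈ A \ A', h i + ∑ i ∈ A' \ A, h i - ∑ i ∈ A ∩ A', h i := by rw [key]; abel

omit [DecidableEq G] in
/-- FOUR-REPRESENTATION RIGIDITY (exponent `3`, `B` sum-distinct): `∑A₀ + ∑A₃ = ∑A₁ + ∑A₂` for subsets of `B`
forces `A₀ ∩ A₃ = A₁ ∩ A₂` and `A₀ ∆ A₃ = A₁ ∆ A₂`. -/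
theorem soloBlind_rep_rigidity (three : ∀ g : G, g + g + g = 0) {h : ι → G} {B : Finset ι}
    (hdist : ∀ A ⊆ B, ∀ A' ⊆ B, ∑ i ∈ A, h i = ∑ i ∈ A', h i → A = A')
    {A₀ A₁ A₂ A₃ : Finset ι} (h₀ : A₀ ⊆ B) (h₁ : A₁ ⊆ B) (h₂ : A₂ ⊆ B) (h₃ : A₃ ⊆ B)
    (e : ∑ i ∈ A₀, h i + ∑ i ∈ A₃, h i = ∑ i ∈ A₁, h i + ∑ i ∈ A₂, h i) :
    A₀ ∩ A₃ = A₁ ∩ A₂ ∧ (A₀ \ A₃ ∪ A₃ \ A₀) = (A₁ \ A₂ ∪ A₂ \ A₁) := by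
  rw [soloBlind_pair_sum_signed three h A₀ A₃, soloBlind_pair_sum_signed three h A₁ A₂] at e
  have dj : ∀ A A' : Finset ι, Disjoint (A \ A' ∪ A' \ A) (A ∩ A') := by
    intro A A'
    rw [Finset.disjoint_left]
    intro i hi hi'
    rw [Finset.mem_inter] at hi'
    rcases Finset.mem_union.mp hi with hi | hi
    · exact (Finset.mem_sdiff.mp hi).2 hi'.2
    · exact (Finset.mem_sdiff.mp hi).2 hi'.1
  have sub : ∀ A A' : Finset ι, A ⊆ B → A' ⊆ B → (A \ A' ∪ A' \ A) ⊆ B := by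
    intro A A' hA hA'
    exact Finset.union_subset (Finset.sdiff_subset.trans hA) (Finset.sdiff_subset.trans hA')
  obtain ⟨hD, hI⟩ := soloBlind_signed_sumDistinct three hdist (sub A₀ A₃ h₀ h₃)
    (Finset.inter_subset_left.trans h₀) (sub A₁ A₂ h₁ h₂) (Finset.inter_subset_left.trans h₁)
    (dj A₀ A₃) (dj A₁ A₂) e
  exact ⟨hI, hD⟩

omit [DecidableEq G] in
/-- Rigidity, pointwise form: under `∑A₀ + ∑A₃ = ∑A₁ + ∑A₂`, an index of `A₁ \ A₃` lies in `A₀` and outside `A₂`. -/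
theorem soloBlind_rep_rigidity_mem (three : ∀ g : G, g + g + g = 0) {h : ι → G} {B : Finset ι}
    (hdist : ∀ A ⊆ B, ∀ A' ⊆ B, ∑ i ∈ A, h i = ∑ i ∈ A', h i → A = A')
    {A₀ A₁ A₂ A₃ : Finset ι} (h₀ : A₀ ⊆ B) (h₁ : A₁ ⊆ B) (h₂ : A₂ ⊆ B) (h₃ : A₃ ⊆ B)
    (e : ∑ i ∈ A₀, h i + ∑ i ∈ A₃, h i = ∑ i ∈ A₁, h i + ∑ i ∈ A₂, h i)
    {x : ι} (hx₁ : x ∈ A₁) (hx₃ : x ∉ A₃) : x ∈ A₀ ∧ x ∉ A₂ := by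
  obtain ⟨hI, hD⟩ := soloBlind_rep_rigidity three hdist h₀ h₁ h₂ h₃ e
  have hx₂ : x ∉ A₂ := by
    intro hx₂
    have hx : x ∈ A₁ ∩ A₂ := Finset.mem_inter.mpr ⟨hx₁, hx₂⟩
    rw [← hI] at hx
    exact hx₃ (Finset.mem_inter.mp hx).2
  refine ⟨?_, hx₂⟩
  have hx : x ∈ A₁ \ A₂ ∪ A₂ \ A₁ := Finset.mem_union_left _ (Finset.mem_sdiff.mpr ⟨hx₁, hx₂⟩)
  rw [← hD] at hx
  rcases Finset.mem_union.mp hx with hx | hx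
  · exact (Finset.mem_sdiff.mp hx).1
  · exact absurd (Finset.mem_sdiff.mp hx).1 hx₃

omit [DecidableEq G] in
/-- Rigidity, pointwise form: under `∑A₀ + ∑A₃ = ∑A₁ + ∑A₂`, an index of `A₀ ∩ A₃` lies in `A₁ ∩ A₂`. -/
theorem soloBlind_rep_rigidity_inter (three : ∀ g : G, g + g + g = 0) {h : ι → G} {B : Finset ι}
    (hdist : ∀ A ⊆ B, ∀ A' ⊆ B, ∑ i ∈ A, h i = ∑ i ∈ A', h i → A = A')
    {A₀ A₁ A₂ A₃ : Finset ι} (h₀ : A₀ ⊆ B) (h₁ : A₁ ⊆ B) (h₂ : A₂ ⊆ B) (h₃ : A₃ ⊆ B)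
    (e : ∑ i ∈ A₀, h i + ∑ i ∈ A₃, h i = ∑ i ∈ A₁, h i + ∑ i ∈ A₂, h i)
    {x : ι} (hx₀ : x ∈ A₀) (hx₃ : x ∈ A₃) : x ∈ A₁ ∧ x ∈ A₂ := by
  obtain ⟨hI, -⟩ := soloBlind_rep_rigidity three hdist h₀ h₁ h₂ h₃ e
  have hx : x ∈ A₀ ∩ A₃ := Finset.mem_inter.mpr ⟨hx₀, hx₃⟩
  rw [hI] at hx
  exact Finset.mem_inter.mp hx

end Summit.MatrixMultiplication.MatrixMultiplication.Theorems
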